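import Mathlib
import Summits.Ventures.PercRepro.TriangleCapFiveRowFourCap

/-!
# PercRepro — THE CAP ON THE CELL `(k, 5, 4)` AT THE SHARP GAP `B2 = 2k − 22`: a `K₄⁻`-free graph with
`5 (k − 5) − 4` edges on `k ≥ 14` vertices with a vertex of degree `k − 5` is `5`-bipartite or at least `2k − 22`
below the closed form (p3, gen 47; part 200a)

The assembly of part 199v (`five_four_cap`) with the arithmetic read one unit tighter: `E = 0` and `M ≤ 1` (for
`K ≥ 10` by the count, for `K = 9` by `five_four_noedge_nine`), `M = 0` is `D ⊆ K(N(x)ᶜ, N(x))`, `M = 1` has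
`P = 4K − 5` with the exact `R`-sum `Σ_R d² ≤ 4K² − 10K + 7` and `Σ_N d² ≤ K + 14 + 6P`, so that
`Σ_v d(v)² ≤ 5K² + 15K − 9 ≤ m k − 4 (k − 5) − (2k − 22) = 5K² + 15K − 8` (`k = K + 5`, `m = 5K − 4`). The bound
is sharp up to parity: the one-triangle family `tFamilyGen (k − 1) 5 1` (`K_{5,k−6}` minus an edge with a vertex hung
on an edge) is a cap graph exactly `2k − 18` below the closed form; the family `B2 = K_{6,k−6}` minus a
`(k − 7)`-star, `2k − 22` below, has no vertex at the cap. Axioms: standard.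
-/

namespace PercRepro

namespace TriangleCap

namespace C047

open Finset

variable {V : Type*} [Fintype V] [DecidableEq V]

/-- **THE ARITHMETIC OF THE CASE `M = 1` AT THE GAP `2k − 22`:** `K ≥ 9`, `m + 4 = 5K`, `P + 5 = 4K`,
`S_N ≤ K + 14 + 6P`, `S_R + 10K ≤ 4K² + 7` ⇒ `K² + S_N + S_R + 4 (k − 5) + (2k − 22) ≤ m k` with `k = K + 5`. -/
theorem five_four_cap_sq_arith_B2 (K P SN SR m : ℕ) (hK : 9 ≤ K) (hm : m + 4 = 5 * K) (hP : P + 5 = 4 * K)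
    (hSN : SN ≤ K + 14 + 6 * P) (hSR : SR + 10 * K ≤ 4 * (K * K) + 7) :
    K * K + SN + SR + 4 * (K + 5 - 5) + (2 * (K + 5) - 22) ≤ m * (K + 5) := by
  obtain ⟨t, rfl⟩ : ∃ t, K = t + 9 := ⟨K - 9, by omega⟩
  have hP' : P = 4 * t + 31 := by omega
  have hm' : m = 5 * t + 41 := by omega
  subst hP' hm'
  have e1 : t + 9 + 5 - 5 = t + 9 := by omega
  have e2 : 2 * (t + 9 + 5) - 22 = 2 * t + 6 := by omega
  rw [e1, e2]
  nlinarith [hSN, hSR]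

/-- **THE CAP ON THE CELL `(k, 5, 4)` AT THE GAP `B2`, `k ≥ 14`:** a `K₄⁻`-free graph with `5 (k − 5) − 4` edges and
a vertex `x` of degree `k − 5` is a spanning subgraph of some `K(A, Aᶜ)` with `|A| = 5`, or
`Σ_v d(v)² + 4 (k − 5) + (2k − 22) ≤ m k`. -/
theorem five_four_cap_B2 (D : SimpleGraph V) [DecidableRel D.Adj] (hK : K4mFree D) (hk : 14 ≤ Fintype.card V)
    (hm : D.edgeFinset.card + 4 = 5 * (Fintype.card V - 5)) (x : V) (hx : deg D x + 5 = Fintype.card V) :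
    (∃ A : Finset V, A.card = 5 ∧ BipSub D A) ∨
      ∑ v, deg D v * deg D v + 4 * (Fintype.card V - 5) + (2 * Fintype.card V - 22) ≤
        D.edgeFinset.card * Fintype.card V := by
  obtain ⟨N, hN⟩ : ∃ N : Finset V, N = univ.filter (fun w => D.Adj x w) := ⟨_, rfl⟩
  have hmemN : ∀ w, w ∈ N ↔ D.Adj x w := fun w => by rw [hN, mem_filter]; simp only [mem_univ, true_and]
  have hxN : x ∉ N := fun h => D.irrefl ((hmemN x).mp h)
  have hdx : deg D x = N.card := by rw [hN]; rfl
  obtain ⟨K, hKdef⟩ : ∃ K, N.card = K := ⟨_, rfl⟩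
  have hcardV : Fintype.card V = K + 5 := by omega
  obtain ⟨m, hmdef⟩ : ∃ m, D.edgeFinset.card = m := ⟨_, rfl⟩
  rw [hmdef, hcardV, Nat.add_sub_cancel] at hm
  -- the non-neighbours `R`, `|R| = 4`
  obtain ⟨R, hR⟩ : ∃ R : Finset V, R = (insert x N)ᶜ := ⟨_, rfl⟩
  have hRcard : R.card = 4 := by
    rw [hR, card_compl, card_insert_of_notMem hxN]
    omega
  have hmemR : ∀ w, w ∈ R ↔ w ≠ x ∧ ¬ D.Adj x w := by
    intro w
    rw [hR, mem_compl, mem_insert, hmemN]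
    tauto
  -- the matching inside `N`
  obtain ⟨M, hM⟩ : ∃ M, adjPairs D N = 2 * M := ⟨_, adjPairs_eq_two_mul D N⟩
  have hTf : ∑ y ∈ N, degIn D N y = 2 * M := by rw [← adjPairs_eq_sum_degIn, hM]
  -- `P = Σ_{u ∈ R} degIn N u`, `E = adjPairs R`
  obtain ⟨P, hPdef⟩ : ∃ P, ∑ u ∈ R, degIn D N u = P := ⟨_, rfl⟩
  obtain ⟨E, hEdef⟩ : ∃ E, adjPairs D R = E := ⟨_, rfl⟩
  -- the degree sum over `{x} ∪ N ∪ R`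
  have hsplit : ∀ F : V → ℕ, ∑ w, F w = F x + ∑ y ∈ N, F y + ∑ u ∈ R, F u := by
    intro F
    rw [← sum_add_sum_compl (insert x N), sum_insert hxN, ← hR]
  have hdegN : ∀ y ∈ N, deg D y = 1 + degIn D N y + degIn D R y := by
    intro y hy
    have := deg_eq_of_mem_nbhd D x y ((hmemN y).mp hy)
    rw [← hN, ← hR] at this
    exact this
  have hsumN : ∑ y ∈ N, deg D y = K + 2 * M + P := by
    rw [sum_congr rfl hdegN, sum_add_distrib, sum_add_distrib, sum_const, smul_eq_mul, mul_one, hKdef, hTf,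
      sum_degIn_comm D N R, hPdef]
  have hdegR : ∀ u ∈ R, deg D u = degIn D N u + degIn D R u := by
    intro u hu
    have := deg_eq_of_not_mem_nbhd D x u ((hmemR u).mp hu).2
    rw [← hN, ← hR] at this
    exact this
  have hsumR : ∑ u ∈ R, deg D u = P + E := by
    rw [sum_congr rfl hdegR, sum_add_distrib, hPdef, ← adjPairs_eq_sum_degIn, hEdef]
  have hdegsum := sum_deg_eq D
  rw [hsplit, hsumN, hsumR, hdx, hKdef, hmdef] at hdegsum
  -- (2) every vertex of `R` has at most `K − M` neighbours in `N`
  have hPle : ∀ u ∈ R, degIn D N u + M ≤ K := by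
    intro u hu
    have := two_mul_degIn_add_adjPairs_le D hK (x := x) ((hmemR u).mp hu).1
    rw [← hN, hM, hKdef] at this
    omega
  have h2 : P + 4 * M ≤ 4 * K := by
    have hs : ∑ u ∈ R, (degIn D N u + M) ≤ ∑ _u ∈ R, K := sum_le_sum hPle
    rw [sum_add_distrib, sum_const, sum_const, smul_eq_mul, smul_eq_mul, hPdef, hRcard] at hs
    exact hs
  -- (3) `E ≤ 8`: `K₄⁻`-freeness on `R`
  have hE8 : E ≤ 8 := by
    have := hK R hRcard
    rw [hEdef] at this
    exact this
  -- (4) an edge inside `R` forces `P + 2M ≤ 3K + 1`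
  have hnoedge : 1 ≤ E → P + 2 * M ≤ 3 * K + 1 := by
    intro hE
    have := five_three_noedge D hK N R hRcard K M hKdef hPle (by rw [hEdef]; exact hE)
    rw [hPdef] at this
    exact this
  -- (5) `E = 0`, `M ≤ 1`
  obtain ⟨hE0, hM1⟩ : E = 0 ∧ M ≤ 1 := by
    rcases Nat.lt_or_ge K 10 with hK9 | hK10
    · have hK9' : K = 9 := by omega
      by_cases hE1 : 1 ≤ E
      · exfalso
        subst hK9'
        obtain ⟨hE8', hM0, hP28⟩ := five_four_cap_count_nine M P E m hdegsum hm hE8 hE1 (hnoedge hE1)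
        subst hM0
        exact five_four_noedge_nine D hK N R hRcard hKdef (fun u hu => by have := hPle u hu; omega)
          (by rw [hPdef]; exact hP28) (by rw [hEdef]; exact hE8')
      · omega
    · exact five_four_cap_count K M P E m hdegsum hm h2 hE8 hK10 hnoedge
  -- no edge inside `R`
  have hnoR : ∀ u ∈ R, degIn D R u = 0 := by
    intro u hu
    have hle : degIn D R u ≤ ∑ z ∈ R, degIn D R z := single_le_sum (fun _ _ => Nat.zero_le _) hu
    rw [← adjPairs_eq_sum_degIn, hEdef, hE0] at hle
    exact Nat.le_zero.mp hle
  rcases Nat.eq_zero_or_pos M with hM0 | hMpos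
  · -- `M = 0`: no edge inside `N`, none inside `R`: `D ⊆ K(Nᶜ, N)`
    left
    have hnoN : ∀ y ∈ N, ∀ y', D.Adj y y' → y' ∉ N := by
      intro y hy y' hyy' hy'
      have h0 : degIn D N y = 0 := by
        have hle : degIn D N y ≤ ∑ z ∈ N, degIn D N z := single_le_sum (fun _ _ => Nat.zero_le _) hy
        rw [hTf, hM0, mul_zero] at hle
        exact Nat.le_zero.mp hle
      unfold degIn at h0
      rw [card_eq_zero, filter_eq_empty_iff] at h0
      exact h0 hy' hyy'
    have hnoR' : ∀ u ∈ R, ∀ u', D.Adj u u' → u' ∉ R := by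
      intro u hu u' huu' hu'
      have h0 := hnoR u hu
      unfold degIn at h0
      rw [card_eq_zero, filter_eq_empty_iff] at h0
      exact h0 hu' huu'
    refine ⟨Nᶜ, ?_, ?_⟩
    · rw [card_compl, hKdef]
      omega
    · intro p q hpq
      rw [mem_compl, mem_compl, not_not]
      constructor
      · intro hpN
        by_contra hqN
        by_cases hpx : p = x
        · subst hpx
          exact hqN ((hmemN q).mpr hpq)
        by_cases hqx : q = x
        · subst hqx
          exact hpN ((hmemN p).mpr (D.adj_symm hpq))
        have hpR : p ∈ R := (hmemR p).mpr ⟨hpx, fun h => hpN ((hmemN p).mpr h)⟩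
        have hqR : q ∈ R := (hmemR q).mpr ⟨hqx, fun h => hqN ((hmemN q).mpr h)⟩
        exact hnoR' p hpR q hpq hqR
      · intro hqN hpN
        exact hnoN p hpN q hpq hqN
  · -- `M = 1`: `P = 4K − 5`, the exact `R`-sum
    right
    have hM1' : M = 1 := by omega
    subst hM1'
    have hP : P + 5 = 4 * K := by omega
    have hSR : ∑ u ∈ R, deg D u * deg D u + 10 * K ≤ 4 * (K * K) + 7 := by
      obtain ⟨u, hu, hu1⟩ : ∃ u ∈ R, True := ⟨_, (card_pos.mp (by omega)).choose_spec, trivial⟩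
      have hcard3 : (R.erase u).card = 3 := by rw [card_erase_of_mem hu, hRcard]
      obtain ⟨v, w, w', hvw, hvw', hww', hR3⟩ := card_eq_three.mp hcard3
      have hv : v ∈ R := mem_of_mem_erase (by rw [hR3]; exact mem_insert_self _ _)
      have hw : w ∈ R := mem_of_mem_erase (by rw [hR3]; exact mem_insert_of_mem (mem_insert_self _ _))
      have hw' : w' ∈ R :=
        mem_of_mem_erase (by rw [hR3]; exact mem_insert_of_mem (mem_insert_of_mem (mem_singleton_self _)))
      have hsum4 : ∀ f : V → ℕ, ∑ t ∈ R, f t = f u + (f v + (f w + f w')) := by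
        intro f
        rw [← add_sum_erase R f hu, hR3, sum_insert, sum_insert, sum_singleton]
        · rw [mem_singleton]; exact hww'
        · rw [mem_insert, mem_singleton]; push Not; exact ⟨hvw, hvw'⟩
      have hdegRu : ∀ t ∈ R, deg D t = degIn D N t := fun t ht => by
        rw [hdegR t ht, hnoR t ht, add_zero]
      have hsumP : degIn D N u + (degIn D N v + (degIn D N w + degIn D N w')) + 5 = 4 * K := by
        rw [← hsum4, hPdef]; exact hP
      rw [hsum4, hdegRu u hu, hdegRu v hv, hdegRu w hw, hdegRu w' hw']
      have := five_four_R_arith _ _ _ _ K (by omega) (hPle u hu) (hPle v hv) (hPle w hw) (hPle w' hw')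
        (by omega)
      omega
    -- `Σ_N d² ≤ K + 14 + 6P`
    have hfg : ∑ y ∈ N, degIn D N y * degIn D R y ≤ 4 := by
      have := two_mul_sum_degIn_mul_degIn_le D hK x R (fun u hu => ((hmemR u).mp hu).1)
      rw [← hN, hM, hRcard] at this
      omega
    have hSN : ∑ y ∈ N, deg D y * deg D y ≤ K + 14 + 6 * P := by
      have h : ∀ y ∈ N, deg D y * deg D y ≤
          1 + 3 * degIn D N y + 6 * degIn D R y + 2 * (degIn D N y * degIn D R y) := by
        intro y hy
        rw [hdegN y hy]
        apply cap_sq_bound_five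
        · have h1 := degIn_nbhd_le_one D hK (x := x) (u := y) ((hmemN y).mp hy)
          rw [← hN] at h1
          exact h1
        · have := degIn_le_card D R y
          rw [hRcard] at this
          exact this
      calc ∑ y ∈ N, deg D y * deg D y
          ≤ ∑ y ∈ N, (1 + 3 * degIn D N y + 6 * degIn D R y + 2 * (degIn D N y * degIn D R y)) := sum_le_sum h
        _ = N.card + 3 * ∑ y ∈ N, degIn D N y + 6 * ∑ y ∈ N, degIn D R y +
            2 * ∑ y ∈ N, degIn D N y * degIn D R y := by
          rw [sum_add_distrib, sum_add_distrib, sum_add_distrib, sum_const, smul_eq_mul, mul_one, mul_sum,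
            mul_sum, mul_sum]
        _ ≤ K + 14 + 6 * P := by
          rw [hKdef, hTf, sum_degIn_comm D N R, hPdef]
          omega
    rw [hsplit (fun v => deg D v * deg D v), hdx, hKdef, hmdef, hcardV]
    exact five_four_cap_sq_arith_B2 K P _ _ m (by omega) hm hP hSN hSR

end C047

end TriangleCap

end PercRepro
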